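import Literature.Claims.NS.Taghizadeh2026
import Literature.Analysis.FluidPDE.SuitableWeakCongr
import Literature.Analysis.FluidPDE.LocalEnergyWeakNSSolutionOn
import Literature.Analysis.FluidPDE.NSSuitableESSProofs
import Literature.Analysis.FluidPDE.VectorCalculus
import Mathlib
import HarnessLib

/-!
# C166 `Taghizadeh2026` — salvage: §4.4 (`Step44_Contradiction`) holds AS TYPED, and Lemma 4.1's rigidity is
# TRUE at the pointwise grain

Skeleton `Literature.Claims.NS.Taghizadeh2026` (ns-claims-typist-10 g5, p541080). Two TRUE-column objects of the
per-step table (records-grade; the row's locator/class are the refuter's and the chair's and are untouched; nothing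
here keys or re-keys the head):

* `step44_holds : ∀ ν lam χ, Step44_Contradiction ν lam χ` — §4.4 p.11 l.37–54 as typed (an ON-PATH binder of
  `claim_of_steps`): an ancient suitable weak solution `(u*, p*, ∇u* = G*)` that vanishes a.e. on every interior
  cylinder `Q_{R/2}(0)` vanishes a.e. on the whole open past (countable exhaustion `past_subset_iUnion_parabolicCylinder`),
  hence its weak spatial gradient vanishes a.e. there (weak gradients survive a.e. modification of the field and
  are a.e. unique: tree `HasWeakSpatialGradientOn.congr_ae`, `.zero`, `.ae_eq`), so each of `E1`, `E^fluc_0`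
  (the weighted mean of an a.e.-zero field is `0`), `C`, `C_harm` at `(1; 0)` is the integral of an a.e.-zero
  function over `Q_1(0) ⊆ past` (`integral_eq_zero_of_ae`) and `I*(1; 0) = 0`; the pressure `p*` is arbitrary.
* `eq_zero_of_fderiv_rankOne_of_divFree` — Lemma 4.1 (p.10 l.70 – p.11 l.36) at the pointwise grain: on a ball,
  `Du(x) h = (−c⟪x, h⟫) u(x)` (`∇u = u ⊗ ∇ log G₀`) and `div u = 0` force `u = 0` (conjugation by `exp(c|x|²/2)`,
  Mathlib `IsOpen.is_const_of_fderiv_eq_zero`; `div u = −c⟪x, u⟫` by the tree's `divergence_eq_sum_inner_fderiv`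
  and Parseval `OrthonormalBasis.sum_inner_mul_inner`). The skeleton's `StepL41_Rigidity` is typed over the
  Bochner-valued `Dfun` (hypothesis `Dfun … = 0`, junk `0` off integrability) and is NOT asserted here.

Rev 2 (appended): `step27_holds : ∀ ν lam χ, Step27_Normalisation ν lam χ` — §2.7 p.6 l.1–4 as typed
(`I(r; z0) = 0` at constant states `(u, p, ∇u) = (a, b, 0)`, with no integrability input: the flux pairings
vanish by the reflection `x ↦ 2x0 − x`, `integral_inner_gradPsi_eq_zero`; the fluctuation term vanishes for either
value of the weighted mass `∫Φ`).

ns-claims-salvage-p2 g6, 2026-08-27. WHAT THIS IS NOT: not a claim about NS regularity or blow-up; not a claim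
about any author beyond the typed locator.
-/

noncomputable section

set_option linter.dupNamespace false

open Set Function Filter MeasureTheory Metric InnerProductSpace
open scoped Topology ENNReal NNReal InnerProductSpace RealInnerProductSpace

namespace Summit.NavierStokesRegularity.NavierStokesRegularity.Theorems.Taghizadeh2026Salvage

open Literature.Analysis.FluidPDE Literature.Claims.NS.Taghizadeh2026

/-! ## Lemma 4.1 at the pointwise grain -/

/-- **Lemma 4.1 (p.10 l.70 – p.11 l.36), the mathematical content at the pointwise grain: rank-one gradient plus
incompressibility forces vanishing.** If a field `u : ℝ³ → ℝ³` is differentiable on the ball `B(0, ρ)` with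
`Du(x) h = (−c⟪x, h⟫) u(x)` there (identity (2) `∂ᵢu = u ∂ᵢ log G₀` with `∇ log G₀(x) = −c x`, `c = 1/(2ν(−t))`;
any `c ≠ 0`) and `div u = 0` there, then `u = 0` on `B(0, ρ)`: the conjugated field `w = exp(c|x|²/2) u` has zero
derivative (printed (3)), so `u(x) = exp(−c|x|²/2) a` (printed (4)); `div u(x) = −c⟪x, u(x)⟫` (trace of the rank-one
map), so `⟪x, a⟫ = 0` on the ball and `a = 0`. [cite: Taghizadeh2026, Lemma 4.1 p.10 l.70 – p.11 l.36] -/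
theorem eq_zero_of_fderiv_rankOne_of_divFree {u : E3 → E3} {c ρ : ℝ} (hc : c ≠ 0) (hρ : 0 < ρ)
    (hdiff : DifferentiableOn ℝ u (ball 0 ρ))
    (hD : ∀ x ∈ ball (0 : E3) ρ, ∀ h : E3, fderiv ℝ u x h = (-c * ⟪x, h⟫) • u x)
    (hdiv : ∀ x ∈ ball (0 : E3) ρ, VectorCalculus.divergence u x = 0) :
    ∀ x ∈ ball (0 : E3) ρ, u x = 0 := by
  -- the conjugated field `w = exp(c|x|²/2) u` has zero derivative on the ball
  set φ : E3 → ℝ := fun x => Real.exp (c / 2 * ‖x‖ ^ 2) with hφ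
  have hφd : ∀ x : E3,
      HasFDerivAt φ (Real.exp (c / 2 * ‖x‖ ^ 2) • ((c / 2) • ((2 : ℝ) • innerSL ℝ x))) x := by
    intro x
    have h1 : HasFDerivAt (fun y : E3 => ‖y‖ ^ 2) ((2 : ℝ) • innerSL ℝ x) x :=
      (hasStrictFDerivAt_norm_sq x).hasFDerivAt.congr_fderiv (by rw [two_nsmul, two_smul])
    exact (h1.const_mul (c / 2)).exp
  set w : E3 → E3 := fun x => φ x • u x with hw
  have hball : IsOpen (ball (0 : E3) ρ) := isOpen_ball
  have hwd : ∀ x ∈ ball (0 : E3) ρ, HasFDerivAt w (0 : E3 →L[ℝ] E3) x := by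
    intro x hx
    have hu : HasFDerivAt u (fderiv ℝ u x) x :=
      ((hdiff x hx).differentiableAt (hball.mem_nhds hx)).hasFDerivAt
    refine ((hφd x).smul hu).congr_fderiv ?_
    ext1 h
    change φ x • fderiv ℝ u x h +
        ((Real.exp (c / 2 * ‖x‖ ^ 2) • ((c / 2) • ((2 : ℝ) • innerSL ℝ x))) h) • u x = (0 : E3)
    rw [hD x hx h, smul_smul, ← add_smul]
    have : φ x * (-c * ⟪x, h⟫) +
        (Real.exp (c / 2 * ‖x‖ ^ 2) • ((c / 2) • ((2 : ℝ) • innerSL ℝ x))) h = 0 := by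
      simp only [hφ, smul_apply, innerSL_apply_apply, smul_eq_mul]; ring
    rw [this, zero_smul]
  have hwdiff : DifferentiableOn ℝ w (ball 0 ρ) := fun x hx =>
    (hwd x hx).differentiableAt.differentiableWithinAt
  have hwconst : ∀ x ∈ ball (0 : E3) ρ, w x = w 0 := fun x hx =>
    hball.is_const_of_fderiv_eq_zero (convex_ball 0 ρ).isPreconnected hwdiff
      (fun y hy => (hwd y hy).fderiv) hx (mem_ball_self hρ)
  -- so `u x = exp(-c|x|²/2) • a` with `a = u 0`
  have hw0 : w 0 = u 0 := by simp [hw, hφ]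
  have hux : ∀ x ∈ ball (0 : E3) ρ, u x = (φ x)⁻¹ • u 0 := by
    intro x hx
    have hφx : φ x ≠ 0 := Real.exp_ne_zero _
    have h1 := hwconst x hx
    rw [hw0] at h1
    simp only [hw] at h1
    rw [← h1, smul_smul, inv_mul_cancel₀ hφx, one_smul]
  -- divergence: `div u (x) = -c ⟪x, u x⟫`
  have hdivx : ∀ x ∈ ball (0 : E3) ρ, VectorCalculus.divergence u x = -c * ⟪x, u x⟫ := by
    intro x hx
    rw [divergence_eq_sum_inner_fderiv (EuclideanSpace.basisFun (Fin 3) ℝ)]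
    simp_rw [hD x hx, real_inner_smul_right]
    rw [← (EuclideanSpace.basisFun (Fin 3) ℝ).sum_inner_mul_inner x (u x), Finset.mul_sum]
    exact Finset.sum_congr rfl fun i _ => by ring
  -- hence `⟪x, u 0⟫ = 0` on the ball, so `u 0 = 0`
  set a : E3 := u 0 with ha
  have horth : ∀ x ∈ ball (0 : E3) ρ, ⟪x, a⟫ = 0 := by
    intro x hx
    have h1 := hdiv x hx
    rw [hdivx x hx, hux x hx, real_inner_smul_right] at h1
    have hφx : (φ x)⁻¹ ≠ 0 := inv_ne_zero (Real.exp_ne_zero _)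
    rcases mul_eq_zero.1 h1 with h | h
    · exact absurd (neg_eq_zero.1 h) hc
    · rcases mul_eq_zero.1 h with h' | h'
      · exact absurd h' hφx
      · exact h'
  have ha0 : a = 0 := by
    by_contra hne
    have hapos : 0 < ‖a‖ := norm_pos_iff.2 hne
    set t : ℝ := ρ / (2 * ‖a‖) with ht
    have htpos : 0 < t := by rw [ht]; positivity
    have hmem : t • a ∈ ball (0 : E3) ρ := by
      rw [mem_ball_zero_iff, norm_smul, Real.norm_of_nonneg htpos.le, ht]
      have : ρ / (2 * ‖a‖) * ‖a‖ = ρ / 2 := by field_simp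
      rw [this]; linarith
    have h1 := horth (t • a) hmem
    rw [real_inner_smul_left, real_inner_self_eq_norm_sq] at h1
    have : t * ‖a‖ ^ 2 ≠ 0 := by positivity
    exact this h1
  intro x hx
  rw [hux x hx, ha0, smul_zero]

/-! ## §4.4 as typed -/


/-- `Q_r(0) ⊆ (−∞,0) × ℝ³`: every backward cylinder at the origin lies in the open past. [cite: Taghizadeh2026, §3.5 p.8 l.52–57] -/
theorem parabolicCylinder_orig_subset_past (r : ℝ) :
    parabolicCylinder r orig ⊆ (past : Set (ℝ × E3)) := by
  intro z hz
  rw [mem_parabolicCylinder] at hz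
  refine mk_mem_prod ?_ (mem_univ _)
  simpa [orig] using hz.1.2

/-- The open past is exhausted by the cylinders `Q_{n+1}(0)`. [cite: Taghizadeh2026, §4.4 p.11 l.37–44] -/
theorem past_subset_iUnion_parabolicCylinder :
    (past : Set (ℝ × E3)) ⊆ ⋃ n : ℕ, parabolicCylinder ((2 * ((n : ℝ) + 1)) / 2) orig := by
  rintro ⟨t, x⟩ hz
  have ht : t < 0 := by simpa [past] using hz
  obtain ⟨n, hn⟩ := exists_nat_gt (max (Real.sqrt (-t)) ‖x‖)
  refine mem_iUnion.2 ⟨n, ?_⟩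
  rw [mem_parabolicCylinder]
  have hR : (2 * ((n : ℝ) + 1)) / 2 = (n : ℝ) + 1 := by ring
  have h1 : Real.sqrt (-t) < (n : ℝ) + 1 := by linarith [le_max_left (Real.sqrt (-t)) ‖x‖]
  have h2 : ‖x‖ < (n : ℝ) + 1 := by linarith [le_max_right (Real.sqrt (-t)) ‖x‖]
  have h3 : -t < ((n : ℝ) + 1) ^ 2 := by
    have hs : Real.sqrt (-t) ^ 2 = -t := Real.sq_sqrt (by linarith)
    have hs0 : 0 ≤ Real.sqrt (-t) := Real.sqrt_nonneg _
    nlinarith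
  refine ⟨⟨?_, ?_⟩, ?_⟩
  · simp only [orig, hR]; linarith
  · simpa [orig] using ht
  · simpa [orig, hR, dist_zero_right] using h2

/-- **§4.4 holds as typed** (p.11 l.37–54: «u* vanishes on the nontrivial interior cylinder … and therefore the
ancient limit must satisfy I*(1; 0) = 0»): an ancient suitable weak solution vanishing a.e. on every interior
cylinder `Q_{R/2}(0)` vanishes a.e. on the open past, so its weak spatial gradient vanishes a.e. there (weak
gradients are a.e. unique, `HasWeakSpatialGradientOn.ae_eq`), and every term of `I(1; 0)` — each carrying a factor
`u*` or `∇u*` — is the integral of an a.e.-zero function over `Q_1(0)`; the pressure `p*` is arbitrary.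
[cite: Taghizadeh2026, §4.4 p.11 l.37–54] -/
theorem step44_holds (ν lam : ℝ) (χ : ℝ → ℝ) : Step44_Contradiction ν lam χ := by
  intro _hν _hlam _hχ us ps Gs hanc hvan
  -- `u* = 0` a.e. on `Q_1(0)` and on the whole open past
  have hQ1 : ∀ᵐ z ∂(volume.restrict (parabolicCylinder 1 orig)), us z.1 z.2 = 0 := by
    have h := hvan 2 two_pos
    norm_num at h
    exact h
  have hpast : ∀ᵐ z ∂(volume.restrict (past : Set (ℝ × E3))), us z.1 z.2 = 0 := by
    have hU : ∀ᵐ z ∂(volume.restrict (⋃ n : ℕ, parabolicCylinder ((2 * ((n : ℝ) + 1)) / 2) orig)),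
        us z.1 z.2 = 0 := by
      rw [ae_restrict_iUnion_iff]
      intro n
      exact hvan _ (by positivity)
    exact ae_restrict_of_ae_restrict_of_subset past_subset_iUnion_parabolicCylinder hU
  -- hence the weak spatial gradient vanishes a.e. on the past, in particular on `Q_1(0)`
  have hgrad0 : HasWeakSpatialGradientOn past (0 : ℝ → E3 → E3) Gs :=
    hanc.grad.congr_ae (by
      filter_upwards [hpast] with z hz
      simpa [uncurry] using hz)
  have hGpast : ∀ᵐ z ∂(volume.restrict (past : Set (ℝ × E3))), Gs z.1 z.2 = 0 := by
    filter_upwards [hgrad0.ae_eq (HasWeakSpatialGradientOn.zero past)] with z hz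
    simpa [uncurry] using hz
  have hGQ1 : ∀ᵐ z ∂(volume.restrict (parabolicCylinder 1 orig)), Gs z.1 z.2 = 0 :=
    ae_restrict_of_ae_restrict_of_subset (parabolicCylinder_orig_subset_past 1) hGpast
  -- every term of `I(1; 0)` is the integral of an a.e.-zero function
  have hE1 : E1 ν χ 1 orig Gs = 0 := by
    unfold E1
    rw [integral_eq_zero_of_ae, mul_zero]
    filter_upwards [hGQ1] with z hz
    simp [hz, frobeniusNormSq_zero]
  have hmean : wmean ν χ 1 orig us = 0 := by
    unfold wmean
    have h2 : (∫ z in parabolicCylinder 1 orig, Phi ν χ 1 orig z.1 z.2 • us z.1 z.2) = 0 := by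
      refine integral_eq_zero_of_ae ?_
      filter_upwards [hQ1] with z hz
      simp [hz]
    rw [h2, smul_zero]
  have hEfluc : Efluc ν χ 1 orig us = 0 := by
    unfold Efluc
    rw [integral_eq_zero_of_ae, mul_zero]
    filter_upwards [hQ1] with z hz
    simp [hz, hmean]
  have hC : Cflux ν χ 1 orig us ps = 0 := by
    unfold Cflux
    rw [integral_eq_zero_of_ae, mul_zero]
    filter_upwards [hQ1] with z hz
    simp [hz]
  have hCh : Charm ν χ 1 orig us ps = 0 := by
    unfold Charm
    rw [integral_eq_zero_of_ae, mul_zero]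
    filter_upwards [hQ1] with z hz
    simp [hz]
  unfold Ifun
  rw [hE1, hEfluc, hC, hCh]
  ring


/-! ## §2.7 as typed: the normalisation `I(r; z0) = 0` at constant states (appended rev 2) -/

/-- **Reflection oddness of a gradient, junk-robust.** If `g : ℝ³ → ℝ` is even about `c/2` in the sense
`g (c − y) = g y`, then `∇g (c − y) = −∇g y` for every `y` — with no differentiability hypothesis (where `g` is not
differentiable both gradients are the junk value `0`). [cite: Taghizadeh2026, §2.5 p.5 l.17–25] -/
theorem gradient_reflect_of_even {g : E3 → ℝ} {c : E3} (h : ∀ y, g (c - y) = g y) (y : E3) :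
    gradient g (c - y) = -gradient g y := by
  have hR : ∀ w : E3, HasFDerivAt (fun w : E3 => c - w) (-(ContinuousLinearMap.id ℝ E3)) w :=
    fun w => (hasFDerivAt_id (𝕜 := ℝ) w).const_sub c
  have hcomp : (g ∘ fun w : E3 => c - w) = g := funext fun w => h w
  -- differentiability transfers across the reflection
  have hdiff : ∀ w : E3, DifferentiableAt ℝ g (c - w) → DifferentiableAt ℝ g w := by
    intro w hw
    have : DifferentiableAt ℝ (g ∘ fun w : E3 => c - w) w := hw.comp w (hR w).differentiableAt
    rwa [hcomp] at this
  by_cases hy : DifferentiableAt ℝ g y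
  · -- chain rule at `c - y`: `D g (c - y) = D g (y) ∘ (−id)`
    have h1 : HasFDerivAt (g ∘ fun w : E3 => c - w) ((fderiv ℝ g y).comp (-(ContinuousLinearMap.id ℝ E3)))
        (c - y) := by
      have hg : HasFDerivAt g (fderiv ℝ g y) ((fun w : E3 => c - w) (c - y)) := by
        rw [show (fun w : E3 => c - w) (c - y) = y from sub_sub_cancel c y]
        exact hy.hasFDerivAt
      exact hg.comp (c - y) (hR (c - y))
    rw [hcomp] at h1
    have h2 : fderiv ℝ g (c - y) = -(fderiv ℝ g y) := by
      rw [h1.fderiv]; ext v; simp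
    simp only [gradient, h2, map_neg]
  · have hy' : ¬ DifferentiableAt ℝ g (c - y) := fun h' => hy (hdiff y h')
    rw [gradient_eq_zero_of_not_differentiableAt hy, gradient_eq_zero_of_not_differentiableAt hy', neg_zero]

/-- `Ψ_{r,z0}(·, t)` is even about `x0`: it depends on `x` through `‖x − x0‖` only. [cite: Taghizadeh2026, §2.4–§2.5 p.4 l.80 – p.5 l.25] -/
theorem Psi_reflect (ν : ℝ) (χ : ℝ → ℝ) (r : ℝ) (z0 : ℝ × E3) (t : ℝ) (y : E3) :
    Psi ν χ r z0 t ((2 : ℝ) • z0.2 - y) = Psi ν χ r z0 t y := by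
  have hn : ‖(2 : ℝ) • z0.2 - y - z0.2‖ = ‖y - z0.2‖ := by
    rw [show (2 : ℝ) • z0.2 - y - z0.2 = -(y - z0.2) by rw [two_smul]; abel, norm_neg]
  unfold Psi Phi heatKer sdist
  simp_rw [hn]

/-- `∇Ψ_{r,z0}(·, t)` is odd about `x0` (junk-robust). [cite: Taghizadeh2026, §2.5 p.5 l.17–25] -/
theorem gradPsi_reflect (ν : ℝ) (χ : ℝ → ℝ) (r : ℝ) (z0 : ℝ × E3) (t : ℝ) (y : E3) :
    gradPsi ν χ r z0 t ((2 : ℝ) • z0.2 - y) = -gradPsi ν χ r z0 t y := by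
  unfold gradPsi
  exact gradient_reflect_of_even (fun w => Psi_reflect ν χ r z0 t w) y

/-- **The flux pairing of a constant direction vanishes on every cylinder**: `∫∫_{Q_r(z0)} ⟪a, ∇Ψ_{r',z0}⟫ = 0`
(reflect `x ↦ 2x0 − x`, a measure-preserving involution of `Q_r(z0)` under which the integrand is odd; valid
for the Bochner integral with or without integrability). [cite: Taghizadeh2026, §2.7 p.6 l.1–4] -/
theorem integral_inner_gradPsi_eq_zero (ν : ℝ) (χ : ℝ → ℝ) (r r' : ℝ) (z0 : ℝ × E3) (a : E3) :
    (∫ z in parabolicCylinder r z0, ⟪a, gradPsi ν χ r' z0 z.1 z.2⟫) = 0 := by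
  -- the reflection as a measure-preserving measurable equivalence of `ℝ × E3`
  set e : ℝ × E3 ≃ᵐ ℝ × E3 :=
    (MeasurableEquiv.refl ℝ).prodCongr (MeasurableEquiv.subLeft ((2 : ℝ) • z0.2)) with he
  have he_apply : ∀ z : ℝ × E3, e z = (z.1, (2 : ℝ) • z0.2 - z.2) := fun z => rfl
  haveI : (volume : Measure E3).IsNegInvariant :=
    Measure.IsAddHaarMeasure.isNegInvariant_of_regular (volume : Measure E3)
  have hmp : MeasurePreserving e (volume : Measure (ℝ × E3)) (volume : Measure (ℝ × E3)) := by
    have h := (MeasurePreserving.id (volume : Measure ℝ)).prod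
      (Measure.measurePreserving_sub_left (volume : Measure E3) ((2 : ℝ) • z0.2))
    exact h
  have hpre : e ⁻¹' parabolicCylinder r z0 = parabolicCylinder r z0 := by
    ext z
    simp only [mem_preimage, he_apply, mem_parabolicCylinder]
    have : dist ((2 : ℝ) • z0.2 - z.2) z0.2 = dist z.2 z0.2 := by
      rw [dist_eq_norm, dist_eq_norm, show (2 : ℝ) • z0.2 - z.2 - z0.2 = -(z.2 - z0.2) by
        rw [two_smul]; abel, norm_neg]
    rw [this]
  have h1 := hmp.setIntegral_preimage_emb e.measurableEmbedding
    (fun z : ℝ × E3 => ⟪a, gradPsi ν χ r' z0 z.1 z.2⟫) (parabolicCylinder r z0)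
  rw [hpre] at h1
  have h2 : (∫ z in parabolicCylinder r z0, ⟪a, gradPsi ν χ r' z0 (e z).1 (e z).2⟫) =
      -∫ z in parabolicCylinder r z0, ⟪a, gradPsi ν χ r' z0 z.1 z.2⟫ := by
    rw [← integral_neg]
    refine integral_congr_ae (Eventually.of_forall fun z => ?_)
    show ⟪a, gradPsi ν χ r' z0 (e z).1 (e z).2⟫ = -⟪a, gradPsi ν χ r' z0 z.1 z.2⟫
    rw [he_apply, gradPsi_reflect, inner_neg_right]
  linarith [h1.symm.trans h2]

/-- **§2.7 holds as typed** («If u ≡ constant and p ≡ constant, then I(r; z0) ≡ 0 for all r > 0», p.6 l.1–4; with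
`∇u = 0`): `E1` has the zero integrand; the weighted mean of the constant field `a` is `a` when `∫Φ ≠ 0` and the
junk `0` when `∫Φ = 0`, and in BOTH cases `E^fluc_0 = r⁻³‖a − (u)_r‖²∫Φ = 0`; the flux pairings `C`, `C_harm` are
constant multiples of `∫∫_{Q_r}⟪a, ∇Ψ_{r,z0}⟫ = 0` (`integral_inner_gradPsi_eq_zero`). No integrability is used.
[cite: Taghizadeh2026, §2.7 p.6 l.1–4] -/
theorem step27_holds (ν lam : ℝ) (χ : ℝ → ℝ) : Step27_Normalisation ν lam χ := by
  intro _hν _hlam _hχ a b z0 r _hr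
  have hE1 : E1 ν χ r z0 (fun _ _ => (0 : E3 →L[ℝ] E3)) = 0 := by
    unfold E1
    simp [frobeniusNormSq_zero]
  have hflux : (∫ z in parabolicCylinder r z0, ⟪a, gradPsi ν χ r z0 z.1 z.2⟫) = 0 :=
    integral_inner_gradPsi_eq_zero ν χ r r z0 a
  have hC : Cflux ν χ r z0 (fun _ _ => a) (fun _ _ => b) = 0 := by
    unfold Cflux
    rw [integral_const_mul, hflux, mul_zero, mul_zero]
  have hCh : Charm ν χ r z0 (fun _ _ => a) (fun _ _ => b) = 0 := by
    unfold Charm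
    rw [integral_const_mul, hflux, mul_zero, mul_zero]
  have hEf : Efluc ν χ r z0 (fun _ _ => a) = 0 := by
    unfold Efluc wmean
    set M : ℝ := ∫ z in parabolicCylinder r z0, Phi ν χ r z0 z.1 z.2 with hM
    have hsm : (∫ z in parabolicCylinder r z0, Phi ν χ r z0 z.1 z.2 • a) = M • a := by
      rw [integral_smul_const]
    rw [hsm, smul_smul]
    by_cases hM0 : M = 0
    · -- junk / zero mass: the mean is `0` and `E^fluc = r⁻³ ‖a‖² ∫Φ = 0`
      have : (∫ z in parabolicCylinder r z0, ‖a - (M⁻¹ * M) • a‖ ^ 2 * Phi ν χ r z0 z.1 z.2) =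
          ‖a - (M⁻¹ * M) • a‖ ^ 2 * M := by rw [integral_const_mul]
      rw [this, hM0]; ring
    · simp [inv_mul_cancel₀ hM0]
  unfold Ifun
  rw [hE1, hEf, hC, hCh]
  ring

end Summit.NavierStokesRegularity.NavierStokesRegularity.Theorems.Taghizadeh2026Salvage

end
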